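import Literature.Combinatorics.Optimization.AcyclicFlowDecomposition
import Literature.Combinatorics.Optimization.CardinalityMatchingPolytopeEF
import Literature.Barriers.PneNP.ExtendedFormulationLinearImage
import HarnessLib

/-!
# Compact extended formulations for cardinality-restricted cycle polytopes
# (Kaibel–Pashkovich–Theis 2012, §5: Theorem 20, Corollary 21) — PROVED

V. Kaibel, K. Pashkovich, D. O. Theis, *Symmetry matters for sizes of extended formulations*,
SIAM J. Discrete Math. 26 (2012) 1361–1382 = arXiv:0911.3712 [KaibelPashkovichTheis2012] (held text
`paper:arxiv-0911.3712`, p0018), verbatim: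

> "**Theorem 20.** For all `n` and `ℓ`, there are extensions for `P^ℓ_cycl(n)` whose sizes can be bounded
> by `2^{O(ℓ)} n³ log n` (and for which the encoding lengths of the coefficients needed to describe them
> can be bounded by a constant)."
> "**Corollary 21.** For all `n` and `ℓ ≤ O(log n)`, there are compact extended formulations for
> `P^ℓ_cycl(n)`."

`P^ℓ_cycl(n)` is the convex hull of the characteristic vectors (in `ℝ^{E(K_n)}`) of the cycles of length
`ℓ` in `K_n` (§1, p0004).  The printed proof (p0018): take maps `φ_1, …, φ_q : [n] → [ℓ]`,
`q ≤ 2^{O(ℓ)} log n`, such that every `ℓ`-set is coloured bijectively by some `φ_i`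
(`CardMatchingEF.exists_perfectHashFamily`, their Thm. 16); `P^ℓ_cycl(n) = conv(P_1 ∪ ⋯ ∪ P_q)` with
`P_i` the convex hull of the COLOURFUL `ℓ`-cycles (`φ_i` bijective on `V(C)`); `P_i = conv ⋃_{v⋆} P_i(v⋆)`
over the vertices `v⋆` of the last colour class; and `P_i(v⋆)` is the projection of the `s`–`t`-path
polytope `Q_i(v⋆)` of the colour-coding dynamic-programming digraph `D` with nodes `(A, v)`
(`A` a set of colours, `v` a vertex with `φ_i(v) ∈ A`) and arcs `s → ({φ_i(v)}, v)`,
`(A, v) → (A ∪ {φ_i(w)}, w)` for `φ_i(w) ∉ A`, `([ℓ−1], v) → t`: "Each `s`-`t`-path in `D` corresponds to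
a cycle in `𝒞_i` that visits `v⋆`, and each such cycle, in turn, corresponds to two `s`-`t`-paths in `D`
[…] `P_i(v⋆)` is the image of `Q_i(v⋆)` under the projection whose component function corresponding to
the edge `{v,w}` of `K_n` is given by the sum of all arc variables corresponding to arcs `((A,v),(A',w))`
[…] if `v⋆ ∉ {v,w}`, and by the sum of the two arc variables corresponding to `(s,({φ_i(w)},w))` and
`(([ℓ−1],w),t)` in case of `v = v⋆`.  Clearly, `Q_i(v⋆)` can be described by the nonnegativity
constraints, the flow conservation constraints […] and […] exactly one flow-unit leaving `s`.  As the
number of arcs of `D` is bounded by `O(2^ℓ·n²)`, we thus have found an extension of `P_i(v⋆)` of the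
desired size."  Both unions are glued by Balas (their Lemma 17; the tree's
`HasEFOfSize.convexHull_biUnion`, `+2` per piece).

## What is proved (no named facts)

* `cycleVec u`, `cycleVectors n ℓ`, `cardCyclePolytope n ℓ` — `P^ℓ_cycl(n)` (cycles as injective closed
  vertex sequences `u : Fin ℓ → Fin n`, edges `{u j, u (j+1 mod ℓ)}`; meaningful for `ℓ ≥ 3`).
* `dag φ v⋆ : Finset (FlowArc (Node n ℓ))` — the colour-coding digraph on ALL pairs
  `Node n ℓ = Finset (Fin ℓ) × Fin n` (graded by `|A|`; unreachable pairs carry no flow), `proj v⋆` — the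
  printed projection as a linear map; **`proj_image_pathVecs`** — the `s`–`t` paths of `dag φ v⋆` project
  exactly onto the colourful `ℓ`-cycles through `v⋆` (both directions of "corresponds");
  **`proj_image_flowPolytope`** — hence `P_i(v⋆) = proj '' Q_i(v⋆)` (flow decomposition,
  `AcyclicFlow.flowPolytope_eq_convexHull`); **`hasEFOfSize_convexHull_starCycles`**.
* **`hasEFOfSize_cardCyclePolytope`** — Theorem 20 with explicit constants:
  `xc(P^ℓ_cycl(n)) ≤ 3^ℓ·ℓ·(⌊log₂ n⌋+1)·(n·(2·4^ℓ n² + 6·2^ℓ n + 4) + 2)` for `ℓ ≥ 3`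
  (we use all `4^ℓ n²`-ish arcs of the complete digraph on `Node n ℓ` as variables, zero off `D` — still
  `2^{O(ℓ)} n²` per piece, as printed); **`KaibelPashkovichTheis2012_thm20`** — the printed shape
  `≤ 2^{7ℓ} · n³ · (⌊log₂ n⌋ + 1)`; **`KaibelPashkovichTheis2012_cor21`** — `ℓ ≤ c log₂ n ⇒ ≤ n^{7c+4}`.
  (Encoding lengths are not recorded by the tree's `HasEFOfSize`; all coefficients here are `0, ±1`.)

## References

* [KaibelPashkovichTheis2012] V. Kaibel, K. Pashkovich, D. O. Theis, *Symmetry matters for sizes of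
  extended formulations*, SIAM J. Discrete Math. 26(3) (2012) 1361–1382, doi:10.1137/110839813,
  arXiv:0911.3712 — §5, Thm. 20, Cor. 21 (p0018).
* [AlonYusterZwick1995] N. Alon, R. Yuster, U. Zwick, *Color-coding*, J. ACM 42 (1995) 844–856 — the
  dynamic-programming digraph ("[AYZ95]" loc. cit.).
* [KorteVygen2018] B. Korte, J. Vygen, *Combinatorial Optimization*, Thm. 8.8 — flow decomposition
  (`AcyclicFlowDecomposition`).
-/

noncomputable section

open Finset Function

namespace Literature.Combinatorics.Optimization

/-! ## §0. Two generic complements on path vectors (arc-space bookkeeping) -/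

namespace AcyclicFlow

variable {X : Type} [Fintype X] [DecidableEq X]

omit [Fintype X] in
/-- A path lies in `D` iff its source arc, its inner arcs and its sink arc do. [cite: KaibelPashkovichTheis2012, §5 (p0018: "all s-t-paths in D")] -/
theorem isPathIn_iff {D : Finset (FlowArc X)} {p : GPath X} :
    IsPathIn D p ↔ srcA (p.v 0) ∈ D ∧ (∀ i : Fin p.len, arcA (p.v i.castSucc) (p.v i.succ) ∈ D) ∧
      snkA (p.v (Fin.last p.len)) ∈ D := by
  constructor
  · intro h
    refine ⟨h _ ?_, fun i => h _ ?_, h _ ?_⟩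
    · simp
    · rw [pathVec_arcA, if_pos ⟨i, rfl, rfl⟩]; exact one_ne_zero
    · simp
  · rintro ⟨hs, ha, ht⟩ a hne
    rcases a with x | ⟨x, y⟩ | x
    · simp only [pathVec] at hne
      split_ifs at hne with hx
      · rw [hx]; exact hs
      · exact absurd rfl hne
    · simp only [pathVec] at hne
      split_ifs at hne with hx
      · obtain ⟨i, h1, h2⟩ := hx
        rw [← h1, ← h2]; exact ha i
      · exact absurd rfl hne
    · simp only [pathVec] at hne
      split_ifs at hne with hx
      · rw [hx]; exact ht
      · exact absurd rfl hne

/-- A linear functional `Σ_a c_a f_a` evaluated at the characteristic vector of an injective path: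
the sum of `c` over the arcs of the path. [cite: KaibelPashkovichTheis2012, §5 (p0018: "the sum of all arc variables corresponding to arcs …")] -/
theorem sum_mul_pathVec {m : ℕ} (v : Fin (m + 1) → X) (hinj : Injective v) (c : FlowArc X → ℝ) :
    ∑ a, c a * pathVec ⟨m, v⟩ a =
      c (srcA (v 0)) + ∑ i : Fin m, c (arcA (v i.castSucc) (v i.succ)) + c (snkA (v (Fin.last m))) := by
  classical
  rw [Fintype.sum_sum_type, Fintype.sum_sum_type]
  have h1 : ∑ x : X, c (Sum.inl x) * pathVec ⟨m, v⟩ (Sum.inl x) = c (srcA (v 0)) := by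
    simp only [pathVec, mul_ite, mul_one, mul_zero, sum_ite_eq', mem_univ, if_true]
  have h3 : ∑ x : X, c (Sum.inr (Sum.inr x)) * pathVec ⟨m, v⟩ (Sum.inr (Sum.inr x)) =
      c (snkA (v (Fin.last m))) := by
    simp only [pathVec, mul_ite, mul_one, mul_zero, sum_ite_eq', mem_univ, if_true]
  have h2 : ∑ q : X × X, c (Sum.inr (Sum.inl q)) * pathVec ⟨m, v⟩ (Sum.inr (Sum.inl q)) =
      ∑ i : Fin m, c (arcA (v i.castSucc) (v i.succ)) := by
    simp only [pathVec, mul_ite, mul_one, mul_zero]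
    rw [← sum_filter]
    have hS : (univ.filter fun q : X × X => ∃ i : Fin m, v i.castSucc = q.1 ∧ v i.succ = q.2) =
        univ.image (fun i : Fin m => (v i.castSucc, v i.succ)) := by
      ext q
      simp only [mem_filter, mem_univ, true_and, mem_image]
      constructor
      · rintro ⟨i, hq1, hq2⟩; exact ⟨i, Prod.ext hq1 hq2⟩
      · rintro ⟨i, rfl⟩; exact ⟨i, rfl, rfl⟩
    rw [hS, sum_image]
    intro i _ j _ h
    exact Fin.castSucc_injective _ (hinj (Prod.ext_iff.1 h).1)
  rw [h1, h2, h3]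
  ring

end AcyclicFlow

namespace CardCycleEF

open AcyclicFlow CardMatchingEF
open Literature.Barriers.PneNP (HasEFOfSize)

variable {n ℓ : ℕ}

/-! ## §1. Cycles of length `ℓ` in `K_n` and the polytope `P^ℓ_cycl(n)` -/

/-- The `j`-th edge `{u j, u (j+1 mod ℓ)}` of the closed vertex sequence `u`. [cite: KaibelPashkovichTheis2012, §1 (p0004)] -/
def cycEdge (u : Fin ℓ → Fin n) (j : Fin ℓ) : Sym2 (Fin n) := s(u j, u (finRotate ℓ j))

/-- Characteristic vector `χ(C) ∈ ℝ^{E(K_n)}` of the edge set of the closed vertex sequence `u`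
(an `ℓ`-cycle when `u` is injective and `ℓ ≥ 3`). [cite: KaibelPashkovichTheis2012, §1 (p0004)] -/
def cycleVec (u : Fin ℓ → Fin n) : KEdge n → ℝ := fun e =>
  if ∃ j : Fin ℓ, (e : Sym2 (Fin n)) = cycEdge u j then 1 else 0

/-- The characteristic vectors of the cycles of length `ℓ` in `K_n`. [cite: KaibelPashkovichTheis2012, §1 (p0004: "`C^ℓ(n)` the set of all cycles of length `ℓ`")] -/
def cycleVectors (n ℓ : ℕ) : Set (KEdge n → ℝ) :=
  {x | ∃ u : Fin ℓ → Fin n, Injective u ∧ x = cycleVec u}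

/-- **The cardinality-restricted cycle polytope `P^ℓ_cycl(n) = conv{χ(C) : C ∈ C^ℓ(n)}`.**
[cite: KaibelPashkovichTheis2012, §1 (p0004)] -/
def cardCyclePolytope (n ℓ : ℕ) : Set (KEdge n → ℝ) :=
  convexHull ℝ (cycleVectors n ℓ)

/-- There are finitely many cycle vectors. [cite: KaibelPashkovichTheis2012, §1 (p0004)] -/
theorem cycleVectors_finite (n ℓ : ℕ) : (cycleVectors n ℓ).Finite :=
  (Set.finite_range fun u : Fin ℓ → Fin n => cycleVec u).subset (by
    rintro x ⟨u, -, rfl⟩; exact ⟨u, rfl⟩)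

/-- `P^ℓ_cycl(n)` is bounded. [cite: KaibelPashkovichTheis2012, §1 (p0004)] -/
theorem isBounded_cardCyclePolytope (n ℓ : ℕ) : Bornology.IsBounded (cardCyclePolytope n ℓ) :=
  isBounded_convexHull.2 (cycleVectors_finite n ℓ).isBounded

/-! ## §2. Colourful cycles (`φ` bijective on `V(C)`) and the pieces through a fixed vertex `v⋆` -/

/-- `𝒞_i`: the cycle vectors of the closed sequences on which `φ` is injective. [cite: KaibelPashkovichTheis2012, §5 (p0018: "`𝒞_i = {C ∈ C^ℓ(n) : φ_i is bijective on V(C)}`")] -/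
def colourfulCycles (φ : Fin n → Fin ℓ) : Set (KEdge n → ℝ) :=
  {x | ∃ u : Fin ℓ → Fin n, Injective (φ ∘ u) ∧ x = cycleVec u}

/-- The generators of `P_i(v⋆)`: colourful cycles visiting `v⋆`. [cite: KaibelPashkovichTheis2012, §5 (p0018: "`P_i(v⋆) = conv{χ(C) : C ∈ 𝒞_i, v⋆ ∈ V(C)}`")] -/
def starCycles (φ : Fin n → Fin ℓ) (v : Fin n) : Set (KEdge n → ℝ) :=
  {x | ∃ u : Fin ℓ → Fin n, Injective (φ ∘ u) ∧ (∃ j, u j = v) ∧ x = cycleVec u}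

/-- Colourful cycles through `v⋆` are cycles. [cite: KaibelPashkovichTheis2012, §5 (p0018)] -/
theorem starCycles_subset_cycleVectors (φ : Fin n → Fin ℓ) (v : Fin n) :
    starCycles φ v ⊆ cycleVectors n ℓ := by
  rintro x ⟨u, hu, -, rfl⟩
  exact ⟨u, hu.of_comp, rfl⟩

/-- `𝒞_i = ⋃_{v⋆} {C ∈ 𝒞_i : v⋆ ∈ V(C)}` (here over all `v⋆ ∈ [n]`). [cite: KaibelPashkovichTheis2012, §5 (p0018: "`P_i = conv ⋃_{v⋆ ∈ V_ℓ} P_i(v⋆)`")] -/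
theorem biUnion_starCycles (hℓ : 1 ≤ ℓ) (φ : Fin n → Fin ℓ) :
    (⋃ v ∈ (univ : Finset (Fin n)), starCycles φ v) = colourfulCycles φ := by
  apply Set.Subset.antisymm
  · intro x hx
    obtain ⟨v, -, hv⟩ := Set.mem_iUnion₂.1 hx
    obtain ⟨u, hu, -, rfl⟩ := hv
    exact ⟨u, hu, rfl⟩
  · rintro x ⟨u, hu, rfl⟩
    exact Set.mem_biUnion (mem_univ (u ⟨0, hℓ⟩)) ⟨u, hu, ⟨⟨0, hℓ⟩, rfl⟩, rfl⟩

/-- `C^ℓ(n) = 𝒞_1 ∪ ⋯ ∪ 𝒞_q` for a family of colourings injective on every `ℓ`-set. [cite: KaibelPashkovichTheis2012, §5 (p0018)] -/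
theorem biUnion_colourfulCycles (Φ : Finset (Fin n → Fin ℓ))
    (hΦ : ∀ W : Finset (Fin n), W.card = ℓ → ∃ φ ∈ Φ, Set.InjOn φ (W : Set (Fin n))) :
    (⋃ φ ∈ Φ, colourfulCycles φ) = cycleVectors n ℓ := by
  classical
  apply Set.Subset.antisymm
  · intro x hx
    obtain ⟨φ, -, hφ⟩ := Set.mem_iUnion₂.1 hx
    obtain ⟨u, hu, rfl⟩ := hφ
    exact ⟨u, hu.of_comp, rfl⟩
  · rintro x ⟨u, hu, rfl⟩
    have hW : (univ.image u).card = ℓ := by rw [card_image_of_injective _ hu, card_univ, Fintype.card_fin]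
    obtain ⟨φ, hφ, hinj⟩ := hΦ _ hW
    refine Set.mem_biUnion hφ ⟨u, fun i j h => hu (hinj ?_ ?_ h), rfl⟩
    · simp
    · simp

/-! ## §3. The colour-coding digraph `D` -/

/-- Nodes `(A, v)`: a set of colours and a vertex (ALL pairs; the printed `D` uses those with `φ v ∈ A`,
the others carry no flow). [cite: KaibelPashkovichTheis2012, §5 (p0018)] -/
abbrev Node (n ℓ : ℕ) : Type := Finset (Fin ℓ) × Fin n

/-- The arcs of `D` for the colouring `φ` and the base vertex `v⋆` (colour `c⋆ = φ v⋆`): `s → ({φ v}, v)`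
(`φ v ≠ c⋆`); `(A, v) → (A ∪ {φ w}, w)` for `φ w ∉ A`, `φ w ≠ c⋆`; `(A, v) → t` iff `A = [ℓ] ∖ {c⋆}`.
[cite: KaibelPashkovichTheis2012, §5 (p0018)] -/
def IsArc (φ : Fin n → Fin ℓ) (vs : Fin n) : FlowArc (Node n ℓ) → Prop
  | Sum.inl x => x.1 = {φ x.2} ∧ φ x.2 ≠ φ vs
  | Sum.inr (Sum.inl q) => φ q.2.2 ∉ q.1.1 ∧ φ q.2.2 ≠ φ vs ∧ q.2.1 = insert (φ q.2.2) q.1.1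
  | Sum.inr (Sum.inr x) => x.1 = univ.erase (φ vs)

/-- The arc set of `D`. [cite: KaibelPashkovichTheis2012, §5 (p0018)] -/
def dag (φ : Fin n → Fin ℓ) (vs : Fin n) : Finset (FlowArc (Node n ℓ)) := by
  classical exact univ.filter (IsArc φ vs)

variable {φ : Fin n → Fin ℓ} {vs : Fin n}

/-- Membership in `dag`. [cite: KaibelPashkovichTheis2012, §5 (p0018)] -/
theorem mem_dag {a : FlowArc (Node n ℓ)} : a ∈ dag φ vs ↔ IsArc φ vs a := by
  classical
  unfold dag
  simp

/-- Source arcs of `D`. [cite: KaibelPashkovichTheis2012, §5 (p0018)] -/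
@[simp] theorem isArc_srcA (x : Node n ℓ) : IsArc φ vs (srcA x) ↔ (x.1 = {φ x.2} ∧ φ x.2 ≠ φ vs) :=
  Iff.rfl

/-- Inner arcs of `D`. [cite: KaibelPashkovichTheis2012, §5 (p0018)] -/
@[simp] theorem isArc_arcA (x y : Node n ℓ) :
    IsArc φ vs (arcA x y) ↔ (φ y.2 ∉ x.1 ∧ φ y.2 ≠ φ vs ∧ y.1 = insert (φ y.2) x.1) :=
  Iff.rfl

/-- Sink arcs of `D`. [cite: KaibelPashkovichTheis2012, §5 (p0018)] -/
@[simp] theorem isArc_snkA (x : Node n ℓ) : IsArc φ vs (snkA x) ↔ x.1 = univ.erase (φ vs) :=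
  Iff.rfl

/-- `D` is acyclic: graded by the number of colours. [cite: KaibelPashkovichTheis2012, §5 (p0018: "a directed acyclic graph D")] -/
theorem dag_graded (φ : Fin n → Fin ℓ) (vs : Fin n) :
    ∀ x y : Node n ℓ, arcA x y ∈ dag φ vs → x.1.card < y.1.card := by
  intro x y h
  rw [mem_dag, isArc_arcA] at h
  rw [h.2.2, card_insert_of_notMem h.1]
  exact Nat.lt_succ_self _

/-! ## §4. The projection to the edge space of `K_n` -/

/-- The edge of `K_n` an arc contributes to: `s → (A,v)` ↦ `{v⋆, v}`, `(A,v) → (A',w)` ↦ `{v, w}`,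
`(A,v) → t` ↦ `{v, v⋆}`. [cite: KaibelPashkovichTheis2012, §5 (p0018)] -/
def edgeOfArc (vs : Fin n) : FlowArc (Node n ℓ) → Sym2 (Fin n)
  | Sum.inl x => s(vs, x.2)
  | Sum.inr (Sum.inl q) => s(q.1.2, q.2.2)
  | Sum.inr (Sum.inr x) => s(x.2, vs)

/-- The printed projection `ℝ^{arcs} → ℝ^{E(K_n)}` as a linear map. [cite: KaibelPashkovichTheis2012, §5 (p0018)] -/
def proj (vs : Fin n) : FlowVec (Node n ℓ) →ₗ[ℝ] (KEdge n → ℝ) :=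
  (Matrix.of fun (e : KEdge n) (a : FlowArc (Node n ℓ)) =>
    if (e : Sym2 (Fin n)) = edgeOfArc vs a then (1 : ℝ) else 0).mulVecLin

/-- Coordinates of the projection. [cite: KaibelPashkovichTheis2012, §5 (p0018)] -/
theorem proj_apply (vs : Fin n) (f : FlowVec (Node n ℓ)) (e : KEdge n) :
    proj vs f e = ∑ a, (if (e : Sym2 (Fin n)) = edgeOfArc vs a then (1 : ℝ) else 0) * f a := by
  simp [proj, Matrix.mulVec, dotProduct]

/-- The projection of the characteristic vector of an injective path `(A_0,w_0) → ⋯ → (A_m,w_m)` of node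
pairs: `[e = {v⋆,w_0}] + Σ_i [e = {w_i,w_{i+1}}] + [e = {w_m,v⋆}]`. [cite: KaibelPashkovichTheis2012, §5 (p0018)] -/
theorem proj_pathVec (vs : Fin n) {m : ℕ} (v : Fin (m + 1) → Node n ℓ) (hinj : Injective v) (e : KEdge n) :
    proj vs (pathVec ⟨m, v⟩) e =
      (if (e : Sym2 (Fin n)) = s(vs, (v 0).2) then (1 : ℝ) else 0) +
        ∑ i : Fin m, (if (e : Sym2 (Fin n)) = s((v i.castSucc).2, (v i.succ).2) then (1 : ℝ) else 0) +
        (if (e : Sym2 (Fin n)) = s((v (Fin.last m)).2, vs) then (1 : ℝ) else 0) := by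
  rw [proj_apply, sum_mul_pathVec v hinj]
  rfl

/-! ## §5. Closed sequences: edge sums, distinct edges, rotation -/

/-- Splitting the edge sum of the closed sequence `(v⋆, w_0, …, w_m)` at `v⋆`. [cite: KaibelPashkovichTheis2012, §5 (p0018)] -/
theorem sum_cycEdge_cons {m : ℕ} (vs : Fin n) (w : Fin (m + 1) → Fin n) (F : Sym2 (Fin n) → ℝ) :
    ∑ j : Fin (m + 2), F (cycEdge (Fin.cons vs w : Fin (m + 2) → Fin n) j) =
      F s(vs, w 0) + ∑ i : Fin m, F s(w i.castSucc, w i.succ) + F s(w (Fin.last m), vs) := by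
  rw [Fin.sum_univ_succ, Fin.sum_univ_castSucc]
  have e0 : cycEdge (Fin.cons vs w : Fin (m + 2) → Fin n) 0 = s(vs, w 0) := by
    have h1 : finRotate (m + 2) 0 = (0 : Fin (m + 1)).succ := by
      rw [finRotate_apply, zero_add, Fin.succ_zero_eq_one]
    rw [cycEdge, h1, Fin.cons_zero, Fin.cons_succ]
  have el : cycEdge (Fin.cons vs w : Fin (m + 2) → Fin n) (Fin.last m).succ = s(w (Fin.last m), vs) := by
    rw [cycEdge, Fin.cons_succ, Fin.succ_last, finRotate_last, Fin.cons_zero]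
  have ei : ∀ i : Fin m, cycEdge (Fin.cons vs w : Fin (m + 2) → Fin n) i.castSucc.succ =
      s(w i.castSucc, w i.succ) := by
    intro i
    have h1 : finRotate (m + 2) i.castSucc.succ = i.succ.succ := by
      apply Fin.ext
      rw [coe_finRotate_of_ne_last]
      · simp [Fin.val_succ]
      · intro h
        have := congrArg Fin.val h
        simp [Fin.val_succ, Fin.val_last] at this
        omega
    rw [cycEdge, h1, Fin.cons_succ, Fin.cons_succ]
  rw [e0, el]
  simp only [ei]
  ring

/-- A sum of indicators of the values of an injective map is the indicator of its range. [folklore: counting] -/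
private theorem sum_ite_eq_ite_exists {ι α : Type} [Fintype ι] [DecidableEq α] (E : ι → α)
    (hE : Injective E) (a : α) [Decidable (∃ j, a = E j)] :
    (∑ j, if a = E j then (1 : ℝ) else 0) = if ∃ j, a = E j then 1 else 0 := by
  split_ifs with h
  · obtain ⟨j0, hj0⟩ := h
    rw [sum_eq_single j0]
    · rw [if_pos hj0]
    · intro j _ hj
      rw [if_neg]
      intro h'
      exact hj (hE (h'.symm.trans hj0))
    · intro h; exact absurd (mem_univ j0) h
  · exact sum_eq_zero fun j _ => if_neg fun h' => h ⟨j, h'⟩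

/-- The `ℓ` edges of an injective closed sequence of length `ℓ ≥ 3` are pairwise distinct. [cite: KaibelPashkovichTheis2012, §1 (p0004: cycles of length ℓ)] -/
theorem cycEdge_injective {m : ℕ} (hm : 1 ≤ m) (c : Fin (m + 2) → Fin n) (hc : Injective c) :
    Injective (cycEdge c) := by
  intro j j' h
  rw [cycEdge, cycEdge, Sym2.eq_iff] at h
  rcases h with ⟨h1, -⟩ | ⟨h1, h2⟩
  · exact hc h1
  · exfalso
    have e1 : j = finRotate (m + 2) j' := hc h1
    have e2 : finRotate (m + 2) j = j' := hc h2
    rw [e1, finRotate_apply, finRotate_apply, add_assoc] at e2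
    have h11 : (1 + 1 : Fin (m + 2)) = 0 := add_left_cancel (e2.trans (add_zero j').symm)
    have hv := congrArg Fin.val h11
    rw [Fin.val_add, Fin.val_one, Nat.mod_eq_of_lt (by omega : 1 + 1 < m + 2), Fin.val_zero] at hv
    omega

/-- Rotating the closed sequence does not change its edge set. [cite: KaibelPashkovichTheis2012, §5 (p0018: "one for each of the two directions of transversal")] -/
theorem cycleVec_rotate {m : ℕ} (u : Fin (m + 1) → Fin n) (j0 : Fin (m + 1)) :
    cycleVec (fun j => u (j + j0)) = cycleVec u := by
  funext e
  have key : (∃ j : Fin (m + 1), (e : Sym2 (Fin n)) = cycEdge (fun j => u (j + j0)) j) ↔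
      ∃ j : Fin (m + 1), (e : Sym2 (Fin n)) = cycEdge u j := by
    simp only [cycEdge, finRotate_apply]
    constructor
    · rintro ⟨j, h⟩
      exact ⟨j + j0, by rw [h, add_right_comm j 1 j0]⟩
    · rintro ⟨j, h⟩
      refine ⟨j - j0, ?_⟩
      rw [sub_add_cancel, add_right_comm (j - j0) 1 j0, sub_add_cancel]
      exact h
  simp only [cycleVec, key]

/-! ## §6. The `s`–`t` paths of `D`: structure -/

section legit

variable {m : ℕ} {v : Fin (m + 1) → Node n ℓ}

/-- The source arc of a path of `D`. [cite: KaibelPashkovichTheis2012, §5 (p0018)] -/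
theorem src_of_isPathIn (hp : IsPathIn (dag φ vs) ⟨m, v⟩) :
    (v 0).1 = {φ (v 0).2} ∧ φ (v 0).2 ≠ φ vs := by
  have h := (isPathIn_iff.1 hp).1
  rw [mem_dag] at h
  exact h

/-- The inner arcs of a path of `D`. [cite: KaibelPashkovichTheis2012, §5 (p0018)] -/
theorem arc_of_isPathIn (hp : IsPathIn (dag φ vs) ⟨m, v⟩) (i : Fin m) :
    φ (v i.succ).2 ∉ (v i.castSucc).1 ∧ φ (v i.succ).2 ≠ φ vs ∧
      (v i.succ).1 = insert (φ (v i.succ).2) (v i.castSucc).1 := by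
  have h := (isPathIn_iff.1 hp).2.1 i
  rw [mem_dag] at h
  exact h

/-- The sink arc of a path of `D`. [cite: KaibelPashkovichTheis2012, §5 (p0018)] -/
theorem snk_of_isPathIn (hp : IsPathIn (dag φ vs) ⟨m, v⟩) : (v (Fin.last m)).1 = univ.erase (φ vs) := by
  have h := (isPathIn_iff.1 hp).2.2
  rw [mem_dag] at h
  exact h

/-- Along a path of `D` the colour sets have sizes `1, 2, …`. [cite: KaibelPashkovichTheis2012, §5 (p0018)] -/
theorem card_of_isPathIn (hp : IsPathIn (dag φ vs) ⟨m, v⟩) : ∀ i : Fin (m + 1), (v i).1.card = i.val + 1 := by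
  intro i
  induction i using Fin.induction with
  | zero => rw [(src_of_isPathIn hp).1, card_singleton]; simp
  | succ i ih =>
    obtain ⟨hni, -, heq⟩ := arc_of_isPathIn hp i
    rw [heq, card_insert_of_notMem hni, ih]
    simp

/-- Each node's own colour belongs to its colour set. [cite: KaibelPashkovichTheis2012, §5 (p0018: "v ∈ φ_i⁻¹(A)")] -/
theorem colour_mem_of_isPathIn (hp : IsPathIn (dag φ vs) ⟨m, v⟩) : ∀ i : Fin (m + 1), φ (v i).2 ∈ (v i).1 := by
  intro i
  induction i using Fin.induction with
  | zero => rw [(src_of_isPathIn hp).1]; exact mem_singleton_self _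
  | succ i _ => rw [(arc_of_isPathIn hp i).2.2]; exact mem_insert_self _ _

/-- The colour sets grow along the path. [cite: KaibelPashkovichTheis2012, §5 (p0018)] -/
theorem mono_of_isPathIn (hp : IsPathIn (dag φ vs) ⟨m, v⟩) : Monotone fun i => (v i).1 :=
  Fin.monotone_iff_le_succ.2 fun i => by
    rw [(arc_of_isPathIn hp i).2.2]
    exact subset_insert _ _

/-- No path vertex has the colour of `v⋆`. [cite: KaibelPashkovichTheis2012, §5 (p0018)] -/
theorem colour_ne_of_isPathIn (hp : IsPathIn (dag φ vs) ⟨m, v⟩) : ∀ i : Fin (m + 1), φ (v i).2 ≠ φ vs := by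
  intro i
  induction i using Fin.induction with
  | zero => exact (src_of_isPathIn hp).2
  | succ i _ => exact (arc_of_isPathIn hp i).2.1

/-- The path vertices have pairwise distinct colours. [cite: KaibelPashkovichTheis2012, §5 (p0018: "φ_i is bijective on V(C)")] -/
theorem colour_injective_of_isPathIn (hp : IsPathIn (dag φ vs) ⟨m, v⟩) :
    Injective fun i : Fin (m + 1) => φ (v i).2 := by
  have key : ∀ i j : Fin (m + 1), i < j → φ (v i).2 ≠ φ (v j).2 := by
    intro i j hij heq
    have hj0 : j ≠ 0 := fun h0 => by
      rw [h0] at hij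
      exact (Fin.not_lt_zero i) hij
    have hj : j = (j.pred hj0).succ := (Fin.succ_pred j hj0).symm
    have hle : i ≤ (j.pred hj0).castSucc := by
      rw [Fin.le_castSucc_iff, ← hj]; exact hij
    have hmem : φ (v i).2 ∈ (v (j.pred hj0).castSucc).1 := mono_of_isPathIn hp hle (colour_mem_of_isPathIn hp i)
    have hnot := (arc_of_isPathIn hp (j.pred hj0)).1
    rw [← hj, ← heq] at hnot
    exact hnot hmem
  intro i j h
  by_contra hne
  rcases lt_or_gt_of_ne hne with hij | hji
  · exact key i j hij h
  · exact key j i hji h.symm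

/-- A path of `D` has exactly `ℓ − 1` nodes: `ℓ = m + 2`. [cite: KaibelPashkovichTheis2012, §5 (p0018)] -/
theorem len_of_isPathIn (hp : IsPathIn (dag φ vs) ⟨m, v⟩) : ℓ = m + 2 := by
  have h1 := card_of_isPathIn hp (Fin.last m)
  rw [snk_of_isPathIn hp, card_erase_of_mem (mem_univ _), card_univ, Fintype.card_fin, Fin.val_last] at h1
  have : 1 ≤ ℓ := Fin.pos (φ vs)
  omega

/-- The closed sequence `(v⋆, w_0, …, w_m)` of a path of `D` is colourful. [cite: KaibelPashkovichTheis2012, §5 (p0018: "Each s-t-path in D corresponds to a cycle in 𝒞_i that visits v⋆")] -/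
theorem colourful_cons_of_isPathIn (hp : IsPathIn (dag φ vs) ⟨m, v⟩) :
    Injective (φ ∘ (Fin.cons vs (fun i => (v i).2) : Fin (m + 2) → Fin n)) := by
  intro a b h
  simp only [comp_apply] at h
  induction a using Fin.cases with
  | zero =>
    induction b using Fin.cases with
    | zero => rfl
    | succ b' =>
      simp only [Fin.cons_zero, Fin.cons_succ] at h
      exact absurd h.symm (colour_ne_of_isPathIn hp b')
  | succ a' =>
    induction b using Fin.cases with
    | zero =>
      simp only [Fin.cons_zero, Fin.cons_succ] at h
      exact absurd h (colour_ne_of_isPathIn hp a')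
    | succ b' =>
      simp only [Fin.cons_succ] at h
      rw [colour_injective_of_isPathIn hp h]

end legit

/-! ## §7. Paths of `D` project onto colourful cycles through `v⋆`, and conversely -/

/-- **Path ⇒ cycle**: the projection of the characteristic vector of an `s`–`t` path of `D` is the
characteristic vector of the closed sequence `(v⋆, w_0, …, w_m)`. [cite: KaibelPashkovichTheis2012, §5 (p0018)] -/
theorem proj_pathVec_eq_cycleVec {m : ℕ} (hm : 1 ≤ m) {φ : Fin n → Fin (m + 2)} {vs : Fin n}
    {v : Fin (m + 1) → Node n (m + 2)} (hp : IsPathIn (dag φ vs) ⟨m, v⟩) :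
    proj vs (pathVec ⟨m, v⟩) = cycleVec (Fin.cons vs (fun i => (v i).2) : Fin (m + 2) → Fin n) := by
  classical
  have hinj : Injective v :=
    injective_of_graded (rk := fun x : Node n (m + 2) => x.1.card) (p := ⟨m, v⟩) fun i =>
      dag_graded φ vs _ _ ((isPathIn_iff.1 hp).2.1 i)
  have hcinj : Injective (Fin.cons vs (fun i => (v i).2) : Fin (m + 2) → Fin n) :=
    (colourful_cons_of_isPathIn hp).of_comp
  funext e
  rw [proj_pathVec vs v hinj e]
  simp only [cycleVec]
  rw [← sum_ite_eq_ite_exists _ (cycEdge_injective hm _ hcinj) (e : Sym2 (Fin n))]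
  exact (sum_cycEdge_cons vs (fun i => (v i).2) fun z => if (e : Sym2 (Fin n)) = z then (1 : ℝ) else 0).symm

/-- The path of `D` traced by a closed sequence `c` with `c 0 = v⋆`: nodes
`({φ c_1, …, φ c_{i+1}}, c_{i+1})`. [cite: KaibelPashkovichTheis2012, §5 (p0018: "each such cycle, in turn, corresponds to two s-t-paths in D")] -/
def pathOfSeq {m : ℕ} (φ : Fin n → Fin (m + 2)) (c : Fin (m + 2) → Fin n) : Fin (m + 1) → Node n (m + 2) :=
  fun i => ((Iic i).image fun i' => φ (c i'.succ), c i.succ)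

/-- **Cycle ⇒ path**: for a colourful closed sequence `c` based at `c 0`, `pathOfSeq` is an `s`–`t` path
of `D`. [cite: KaibelPashkovichTheis2012, §5 (p0018)] -/
theorem isPathIn_pathOfSeq {m : ℕ} {φ : Fin n → Fin (m + 2)} {c : Fin (m + 2) → Fin n}
    (hc : Injective (φ ∘ c)) : IsPathIn (dag φ (c 0)) ⟨m, pathOfSeq φ c⟩ := by
  classical
  have hne : ∀ i : Fin (m + 1), φ (c i.succ) ≠ φ (c 0) := fun i h =>
    Fin.succ_ne_zero _ (hc h)
  refine isPathIn_iff.2 ⟨?_, fun i => ?_, ?_⟩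
  · rw [mem_dag, isArc_srcA]
    refine ⟨?_, hne 0⟩
    show ((Iic (0 : Fin (m + 1))).image fun i' => φ (c i'.succ)) = {φ (c (0 : Fin (m + 1)).succ)}
    have : Iic (0 : Fin (m + 1)) = {0} := by
      ext i; rw [mem_Iic, mem_singleton, Fin.le_zero_iff]
    rw [this, image_singleton]
  · rw [mem_dag, isArc_arcA]
    refine ⟨fun h => ?_, hne i.succ, ?_⟩
    · -- a repeated colour among c_1..c_{i+1}, c_{i+2}
      obtain ⟨i', hi', heq⟩ := mem_image.1 h
      rw [mem_Iic] at hi'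
      have := hc heq
      have hv := congrArg Fin.val this
      simp only [Fin.val_succ] at hv
      have hle : i'.val ≤ i.val := hi'
      omega
    · show ((Iic i.succ).image fun i' => φ (c i'.succ)) =
        insert (φ (c i.succ.succ)) ((Iic i.castSucc).image fun i' => φ (c i'.succ))
      have : Iic i.succ = insert i.succ (Iic i.castSucc) := by
        ext i'
        rw [mem_Iic, mem_insert, mem_Iic, Fin.le_castSucc_iff]
        constructor
        · intro h; exact (lt_or_eq_of_le h).symm
        · rintro (h | h)
          · exact h.le
          · exact h.le
      rw [this, image_insert]
  · rw [mem_dag, isArc_snkA]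
    show ((Iic (Fin.last m)).image fun i' => φ (c i'.succ)) = univ.erase (φ (c 0))
    have hI : Iic (Fin.last m) = univ := by
      ext i; simp [Fin.le_last]
    rw [hI]
    apply eq_of_subset_of_card_le
    · intro x hx
      obtain ⟨i', -, rfl⟩ := mem_image.1 hx
      exact mem_erase.2 ⟨hne i', mem_univ _⟩
    · have hinj' : Injective (fun i' : Fin (m + 1) => φ (c i'.succ)) := fun a b h =>
        Fin.succ_injective _ (hc h)
      rw [card_erase_of_mem (mem_univ _), card_univ, Fintype.card_fin,
        card_image_of_injective _ hinj', card_univ, Fintype.card_fin]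
      omega

/-- **"Each `s`-`t`-path in `D` corresponds to a cycle in `𝒞_i` that visits `v⋆`, and each such cycle, in
turn, corresponds to [two] `s`-`t`-paths in `D`"**: the path vectors of `D` project exactly onto the
colourful cycle vectors through `v⋆`. [cite: KaibelPashkovichTheis2012, §5 (p0018)] -/
theorem proj_image_pathVecs (hℓ : 3 ≤ ℓ) (φ : Fin n → Fin ℓ) (vs : Fin n) :
    proj vs '' {q | ∃ p : GPath (Node n ℓ), IsPathIn (dag φ vs) p ∧ q = pathVec p} = starCycles φ vs := by
  classical
  apply Set.Subset.antisymm
  · rintro _ ⟨_, ⟨⟨m, v⟩, hp, rfl⟩, rfl⟩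
    have hℓm := len_of_isPathIn hp
    subst hℓm
    exact ⟨Fin.cons vs (fun i => (v i).2), colourful_cons_of_isPathIn hp, ⟨0, by simp⟩,
      proj_pathVec_eq_cycleVec (by omega) hp⟩
  · rintro x ⟨u, hu, ⟨j0, hj0⟩, rfl⟩
    obtain ⟨m, rfl⟩ : ∃ m, ℓ = m + 2 := ⟨ℓ - 2, by omega⟩
    set c : Fin (m + 2) → Fin n := fun j => u (j + j0) with hc
    have hc0 : c 0 = vs := by simp [hc, hj0]
    have hcinj : Injective (φ ∘ c) := fun a b h => add_right_cancel (hu h)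
    rw [← cycleVec_rotate u j0]
    have hpath : IsPathIn (dag φ vs) ⟨m, pathOfSeq φ c⟩ := by
      rw [← hc0]; exact isPathIn_pathOfSeq hcinj
    refine ⟨pathVec ⟨m, pathOfSeq φ c⟩, ⟨⟨m, pathOfSeq φ c⟩, hpath, rfl⟩, ?_⟩
    rw [proj_pathVec_eq_cycleVec (by omega) hpath]
    show cycleVec (Fin.cons vs (fun i => c i.succ) : Fin (m + 2) → Fin n) = cycleVec c
    rw [← hc0]
    exact congrArg cycleVec (Fin.cons_self_tail c)

/-- **`P_i(v⋆)` is the projection of the path polytope `Q_i(v⋆)`** (flow decomposition in the acyclic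
digraph `D` + linearity of `proj`). [cite: KaibelPashkovichTheis2012, §5 (p0018: "`P_i(v⋆)` is the image of `Q_i(v⋆)` under the projection")] -/
theorem proj_image_flowPolytope (hℓ : 3 ≤ ℓ) (φ : Fin n → Fin ℓ) (vs : Fin n) :
    proj vs '' flowPolytope (dag φ vs) = convexHull ℝ (starCycles φ vs) := by
  rw [flowPolytope_eq_convexHull (fun x : Node n ℓ => x.1.card) (dag_graded φ vs),
    LinearMap.image_convexHull, proj_image_pathVecs hℓ]

/-- The size of the flow extension of one piece: `2·|arcs| + 2·|nodes| + 2`. [cite: KaibelPashkovichTheis2012, §5 (p0018: "extensions of the `P_i(v⋆)`, whose sizes are bounded by `O(2^ℓ·n²)`")] -/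
def pieceSize (n ℓ : ℕ) : ℕ := 2 * Fintype.card (FlowArc (Node n ℓ)) + 2 * Fintype.card (Node n ℓ) + 2

/-- **Each `P_i(v⋆)` has an extended formulation of size `pieceSize n ℓ = 2^{O(ℓ)} n²`.** [cite: KaibelPashkovichTheis2012, §5 (p0018)] -/
theorem hasEFOfSize_convexHull_starCycles (hℓ : 3 ≤ ℓ) (φ : Fin n → Fin ℓ) (vs : Fin n) :
    HasEFOfSize (convexHull ℝ (starCycles φ vs)) (pieceSize n ℓ) := by
  have h := (hasEFOfSize_flowPolytope (dag φ vs)).image_linearMap (proj vs)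
  rwa [proj_image_flowPolytope hℓ] at h

/-! ## §8. Gluing: Theorem 20 and Corollary 21 -/

/-- `conv ⋃ conv S_a = conv ⋃ S_a`. [folklore: convex hull idempotence] -/
private theorem convexHull_biUnion_convexHull {α E : Type} [AddCommGroup E] [Module ℝ E] (s : Finset α)
    (S : α → Set E) : convexHull ℝ (⋃ a ∈ s, convexHull ℝ (S a)) = convexHull ℝ (⋃ a ∈ s, S a) := by
  apply Set.Subset.antisymm
  · refine convexHull_min (Set.iUnion₂_subset fun a ha => ?_) (convex_convexHull ℝ _)
    exact convexHull_mono (Set.subset_biUnion_of_mem (u := fun a => S a) ha)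
  · exact convexHull_mono (Set.iUnion₂_mono fun a _ => subset_convexHull ℝ (S a))

/-- **`P_i = conv ⋃_{v⋆} P_i(v⋆)` has an extended formulation of size `n · (pieceSize + 2)`** (Balas).
[cite: KaibelPashkovichTheis2012, §5 (p0018) with Lemma 17 (p0016)] -/
theorem hasEFOfSize_convexHull_colourfulCycles (hℓ : 3 ≤ ℓ) (φ : Fin n → Fin ℓ) :
    HasEFOfSize (convexHull ℝ (colourfulCycles φ)) (n * (pieceSize n ℓ + 2)) := by
  classical
  have h := HasEFOfSize.convexHull_biUnion (univ : Finset (Fin n)) (fun v => convexHull ℝ (starCycles φ v))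
    (fun _ => pieceSize n ℓ)
    (fun v _ => (isBounded_cardCyclePolytope n ℓ).subset (convexHull_mono (starCycles_subset_cycleVectors φ v)))
    (fun v _ => hasEFOfSize_convexHull_starCycles hℓ φ v)
  rwa [convexHull_biUnion_convexHull, biUnion_starCycles (by omega), sum_const, card_univ, Fintype.card_fin,
    smul_eq_mul] at h

/-- **`P^ℓ_cycl(n) = conv(P_1 ∪ ⋯ ∪ P_q)` has an extended formulation of size `q · (n·(pieceSize+2) + 2)`,
`q ≤ 3^ℓ·ℓ·(⌊log₂ n⌋+1)`.** [cite: KaibelPashkovichTheis2012, Thm. 20 (p0018)] -/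
theorem hasEFOfSize_cardCyclePolytope_pieceSize (n ℓ : ℕ) (hℓ : 3 ≤ ℓ) :
    ∃ r : ℕ, r ≤ 3 ^ ℓ * (ℓ * (Nat.log 2 n + 1)) * (n * (pieceSize n ℓ + 2) + 2) ∧
      HasEFOfSize (cardCyclePolytope n ℓ) r := by
  classical
  obtain ⟨Φ, hcard, hΦ⟩ := exists_perfectHashFamily n ℓ (by omega)
  have h := HasEFOfSize.convexHull_biUnion Φ (fun φ => convexHull ℝ (colourfulCycles φ))
    (fun _ => n * (pieceSize n ℓ + 2))
    (fun φ _ => (isBounded_cardCyclePolytope n ℓ).subset (convexHull_mono (by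
      rintro x ⟨u, hu, rfl⟩; exact ⟨u, hu.of_comp, rfl⟩)))
    (fun φ _ => hasEFOfSize_convexHull_colourfulCycles hℓ φ)
  rw [convexHull_biUnion_convexHull, biUnion_colourfulCycles Φ hΦ, sum_const, smul_eq_mul] at h
  exact ⟨_, Nat.mul_le_mul_right _ hcard, h⟩

/-- `|Node n ℓ| = 2^ℓ · n`. [cite: KaibelPashkovichTheis2012, §5 (p0018)] -/
theorem card_node (n ℓ : ℕ) : Fintype.card (Node n ℓ) = 2 ^ ℓ * n := by
  simp [Node, Fintype.card_prod, Fintype.card_finset, Fintype.card_fin]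

/-- `pieceSize n ℓ + 2 = 2·4^ℓ n² + 6·2^ℓ n + 4`. [cite: KaibelPashkovichTheis2012, §5 (p0018: "`O(2^ℓ·n²)`")] -/
theorem pieceSize_add_two (n ℓ : ℕ) : pieceSize n ℓ + 2 = 2 * 4 ^ ℓ * n ^ 2 + 6 * 2 ^ ℓ * n + 4 := by
  rw [pieceSize, card_flowArc, card_node]
  have h4 : (4 : ℕ) ^ ℓ = (2 ^ ℓ) ^ 2 := by
    rw [← pow_mul, mul_comm, pow_mul]; norm_num
  rw [h4]
  ring

/-- **Kaibel–Pashkovich–Theis 2012, Theorem 20 — PROVED with explicit constants**: for `ℓ ≥ 3`,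
`xc(P^ℓ_cycl(n)) ≤ 3^ℓ·ℓ·(⌊log₂ n⌋+1)·(n·(2·4^ℓ n² + 6·2^ℓ n + 4) + 2)` (`= 2^{O(ℓ)} n³ log n`).
[cite: KaibelPashkovichTheis2012, Thm. 20 (p0018)] -/
theorem hasEFOfSize_cardCyclePolytope (n ℓ : ℕ) (hℓ : 3 ≤ ℓ) :
    ∃ r : ℕ, r ≤ 3 ^ ℓ * (ℓ * (Nat.log 2 n + 1)) * (n * (2 * 4 ^ ℓ * n ^ 2 + 6 * 2 ^ ℓ * n + 4) + 2) ∧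
      HasEFOfSize (cardCyclePolytope n ℓ) r := by
  rw [← pieceSize_add_two]
  exact hasEFOfSize_cardCyclePolytope_pieceSize n ℓ hℓ

/-- For `n = 0` (indeed `n < ℓ`) there are no `ℓ`-cycles. [cite: KaibelPashkovichTheis2012, §1 (p0004)] -/
theorem cycleVectors_eq_empty (hℓ : 1 ≤ ℓ) : cycleVectors 0 ℓ = ∅ := by
  ext x
  simp only [cycleVectors, Set.mem_setOf_eq, Set.mem_empty_iff_false, iff_false]
  rintro ⟨u, -, -⟩
  exact (u ⟨0, hℓ⟩).elim0

/-- The empty set has an extended formulation of size `0` (Balas over the empty family). [folklore] -/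
private theorem hasEFOfSize_empty : HasEFOfSize (∅ : Set (KEdge n → ℝ)) 0 := by
  have h := Literature.Barriers.PneNP.HasEFOfSize.convexHull_biUnion (ι := KEdge n)
    (∅ : Finset Unit) (fun _ => ∅) (fun _ => 0) (fun _ h => absurd h (Finset.notMem_empty _))
    (fun _ h => absurd h (Finset.notMem_empty _))
  simpa using h

/-- **Theorem 20 in the printed shape `2^{O(ℓ)} n³ log n`**: `xc(P^ℓ_cycl(n)) ≤ 2^{7ℓ} · n³ · (⌊log₂ n⌋ + 1)`
for `ℓ ≥ 3`. [cite: KaibelPashkovichTheis2012, Thm. 20 (p0018)] -/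
theorem KaibelPashkovichTheis2012_thm20 (n ℓ : ℕ) (hℓ : 3 ≤ ℓ) :
    ∃ r : ℕ, r ≤ 2 ^ (7 * ℓ) * n ^ 3 * (Nat.log 2 n + 1) ∧ HasEFOfSize (cardCyclePolytope n ℓ) r := by
  rcases Nat.eq_zero_or_pos n with rfl | hn
  · refine ⟨0, Nat.zero_le _, ?_⟩
    rw [cardCyclePolytope, cycleVectors_eq_empty (by omega), convexHull_empty]
    exact hasEFOfSize_empty
  obtain ⟨r, hr, hEF⟩ := hasEFOfSize_cardCyclePolytope n ℓ hℓ
  refine ⟨r, hr.trans ?_, hEF⟩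
  set L := Nat.log 2 n + 1
  -- the bracket is at most `14 · 4^ℓ · n³`
  have hA : 2 ^ ℓ ≤ 4 ^ ℓ := Nat.pow_le_pow_left (by norm_num) ℓ
  have hA1 : 1 ≤ 4 ^ ℓ := Nat.one_le_pow _ _ (by norm_num)
  have hn3 : n ≤ n ^ 3 := by
    calc n = n ^ 1 := (pow_one n).symm
      _ ≤ n ^ 3 := Nat.pow_le_pow_right hn (by norm_num)
  have hn23 : n ^ 2 ≤ n ^ 3 := Nat.pow_le_pow_right hn (by norm_num)
  have hn13 : 1 ≤ n ^ 3 := Nat.one_le_pow _ _ hn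
  have p1 : 2 ^ ℓ * n ^ 2 ≤ 4 ^ ℓ * n ^ 3 := Nat.mul_le_mul hA hn23
  have p2 : n ≤ 4 ^ ℓ * n ^ 3 := by
    calc n = 1 * n := (one_mul n).symm
      _ ≤ 4 ^ ℓ * n ^ 3 := Nat.mul_le_mul hA1 hn3
  have p3 : 1 ≤ 4 ^ ℓ * n ^ 3 := Nat.mul_le_mul hA1 hn13
  have hbr : n * (2 * 4 ^ ℓ * n ^ 2 + 6 * 2 ^ ℓ * n + 4) + 2 ≤ 14 * 4 ^ ℓ * n ^ 3 := by
    have e : n * (2 * 4 ^ ℓ * n ^ 2 + 6 * 2 ^ ℓ * n + 4) + 2 =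
        2 * (4 ^ ℓ * n ^ 3) + 6 * (2 ^ ℓ * n ^ 2) + 4 * n + 2 := by ring
    rw [e]
    linarith
  -- the constant: `3^ℓ · ℓ · 14 · 4^ℓ ≤ 2^{7ℓ}`
  have hℓ2 : ℓ ≤ 2 ^ ℓ := Nat.lt_two_pow_self.le
  have h14 : 14 ≤ 2 * 2 ^ ℓ := by
    have : 2 ^ 3 ≤ 2 ^ ℓ := Nat.pow_le_pow_right (by norm_num) hℓ
    omega
  have h2ℓ : 2 ≤ 2 ^ ℓ := by
    calc 2 = 2 ^ 1 := by norm_num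
      _ ≤ 2 ^ ℓ := Nat.pow_le_pow_right (by norm_num) (by omega)
  have hC : 3 ^ ℓ * ℓ * 14 * 4 ^ ℓ ≤ 2 ^ (7 * ℓ) := by
    calc 3 ^ ℓ * ℓ * 14 * 4 ^ ℓ ≤ 3 ^ ℓ * 2 ^ ℓ * (2 * 2 ^ ℓ) * 4 ^ ℓ := by gcongr
      _ = 2 * 48 ^ ℓ := by
          rw [show (48 : ℕ) = 3 * 2 * 2 * 4 by norm_num, mul_pow, mul_pow, mul_pow]; ring
      _ ≤ 2 ^ ℓ * 48 ^ ℓ := Nat.mul_le_mul_right _ h2ℓ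
      _ = 96 ^ ℓ := by rw [← mul_pow]; norm_num
      _ ≤ 128 ^ ℓ := Nat.pow_le_pow_left (by norm_num) ℓ
      _ = 2 ^ (7 * ℓ) := by rw [pow_mul]; norm_num
  calc 3 ^ ℓ * (ℓ * L) * (n * (2 * 4 ^ ℓ * n ^ 2 + 6 * 2 ^ ℓ * n + 4) + 2)
      ≤ 3 ^ ℓ * (ℓ * L) * (14 * 4 ^ ℓ * n ^ 3) := Nat.mul_le_mul_left _ hbr
    _ = (3 ^ ℓ * ℓ * 14 * 4 ^ ℓ) * n ^ 3 * L := by ring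
    _ ≤ 2 ^ (7 * ℓ) * n ^ 3 * L := by gcongr

/-- **Kaibel–Pashkovich–Theis 2012, Corollary 21 — compact extended formulations for `ℓ = O(log n)`:**
if `3 ≤ ℓ ≤ c·⌊log₂ n⌋` then `xc(P^ℓ_cycl(n)) ≤ n^{7c+4}`.  (By their Theorem 18 / Corollary 19 (p0017), via
Yannakakis 1991, there is NO compact SYMMETRIC extended formulation of `P^ℓ_cycl(n)` for `ℓ = Θ(log n)` — "symmetry
matters"; that lower bound is not formalised here.) [cite: KaibelPashkovichTheis2012, Cor. 21 (p0018)] -/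
theorem KaibelPashkovichTheis2012_cor21 (c n ℓ : ℕ) (hℓ : 3 ≤ ℓ) (hc : ℓ ≤ c * Nat.log 2 n) :
    ∃ r : ℕ, r ≤ n ^ (7 * c + 4) ∧ HasEFOfSize (cardCyclePolytope n ℓ) r := by
  obtain ⟨r, hr, hEF⟩ := KaibelPashkovichTheis2012_thm20 n ℓ hℓ
  refine ⟨r, hr.trans ?_, hEF⟩
  rcases Nat.eq_zero_or_pos n with rfl | hn
  · simp at hc; omega
  have hlog : 2 ^ Nat.log 2 n ≤ n := Nat.pow_log_le_self 2 hn.ne'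
  have hL : Nat.log 2 n + 1 ≤ n := Nat.log_lt_self 2 hn.ne'
  calc 2 ^ (7 * ℓ) * n ^ 3 * (Nat.log 2 n + 1) ≤ 2 ^ (7 * (c * Nat.log 2 n)) * n ^ 3 * n := by
        gcongr
        · norm_num
    _ = (2 ^ Nat.log 2 n) ^ (7 * c) * n ^ 4 := by
        rw [← pow_mul]; ring_nf
    _ ≤ n ^ (7 * c) * n ^ 4 := by gcongr
    _ = n ^ (7 * c + 4) := by rw [← pow_add]

end CardCycleEF

end Literature.Combinatorics.Optimization

end
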